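import Summits.AtomisticToContinuum.Crystallization.Theorems.LoopTunnelDialFinPushLoad

/-!
# LoopTunnelDial — FORCE PRICING, part A: HOT as ONE balance-free dipole capacity (kit 14A; the certificate format is part B)
(lens-5 generation 26; crux `PocketCase`, stmt-AtomisticToContinuum-27294; preview of record v8.8 `717ac4a4`, stub 3 HOT = `ContactHotAbove (3/4)`)

Critic row 349 (4) ordered the CERTIFICATE FORMAT on the Lean side for the piece of `PocketCase` with a live certificate path (the contact
law HOT; rows 307/332/343: near part by branch-and-bound, far load by a one-centre capacity bound = census TAG 129 I-CAP) together with a checker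
skeleton.  This file (part A: §1–§3) and its sequel `LoopTunnelDialForcePricingCert` (part B: §4–§5) deliver it in the sharper PRICED form and
prove every bridge (0 sorry):

§1 PRICING IDENTITY (exact, every price `c : ℝ`).  At a force-balanced particle `p` with partner `q` at distance `a`, testing the balance against
   `e := y q − y p` and adding `c ×` it to the energy gives
   `𝓔ᵖ = V(a) + c·(a⁻¹² − a⁻⁶) + ∑_{m ≠ p,q} [V(r_{pm}) + c·forceTerm (y p) (y m) (y q − y p)]`           (`siteEnergy_eq_priced`).
   The bracket is the PRICED PAIR WEIGHT `pricedTerm c x q z`: the Lennard-Jones energy of the pair PLUS the price `c` times the (signed) axial push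
   that `z` exerts on `x` away from `q` (a DIPOLE weight: repulsive points behind `x` and attractive points in front of `x` earn, the mirror
   positions pay).  Lagrangian relaxation: the balance constraint is SOLD at price `c`; what remains is balance-free.
§2 `PricedLoadCap ρ c Λ` — ONE-CENTRE, BALANCE-FREE, GS-free, `μ`-free, `e⋆`-free, `N`-free: in every injective `7/10`-separated configuration,
   at a pair `p ≠ q` closer than `ρ`, the priced load `−∑_{m ≠ p,q} pricedTerm` is at most `Λ`.  PROVED: `PricedLoadCap ρ c Λ` and a partner floor
   `m ≤ V(a) + c(a⁻¹² − a⁻⁶)` on `[7/10, ρ)` give `ContactHot ρ (m − Λ)` (`contactHot_of_pricedLoadCap`); at `ρ = 3/4`, `c ≥ 0` the floor is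
   `m(c) = (4/3)¹²(1/12 + c) − (4/3)⁶(1/6 + c) = 2701312/1594323 + (13791232/531441)·c ≈ 1.694 + 25.95·c` (`partnerFloor_threeQuarters`), whence
   **HOT ⟸ `PricedLoadCap (3/4) c Λ` with `Λ < m(c) + 0.711`** given the landed `e⋆ ≤ −0.711` (`contactHotAbove_threeQuarters_of_priced`;
   instance `c = 8/125`, `Λ = 4`: `contactHotAbove_threeQuarters_of_priced_064`).  The price is a DIAL; `c = 0` is the (false) naked load bound,
   the break-even price of the census's optimal pusher (`r ≈ 0.764`, push `26.5`, cost `1.27`) is `c⋆ ≈ 1.27/(0.75·26.5) ≈ 0.064`.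
§3 RANGE DIAL.  `FinPricedLoadCap ρ c Λ R` (point sets in one closed `R`-ball, no balance) and ANY certified tails `FarTails R E F` (tree: dyadic,
   integer shells `farTails_shells`) give `PricedLoadCap ρ c (Λ + E + c·ρ·F)` (`pricedLoadCap_of_fin_of_farTails`); at `n = 5`, `c = 8/125`:
   `FinPricedLoadCap (3/4) (8/125) (77/20) 5 ⟹ ContactHotAbove (3/4)` (`contactHotAbove_threeQuarters_of_finPriced5`).
§4 THE CERTIFICATE FORMAT `CellCert` (what census must output for I-CAP, TAG 129) and its PROVED soundness `CellCert.sum_le`: finitely many CELLS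
   `cell i ⊂ ℝ³` covering the admissible region about `(x, q)` (`7/10 ≤ |z − x| ≤ R`, `|z − q| ≥ 7/10`), a WEIGHT MAJORANT `wt i ≥ sup_{cell i} w`,
   CLIQUES = cell families whose union has diameter `< 7/10` (hence holds AT MOST ONE point of a `7/10`-separated set — no packing theorem needed),
   and a DUAL VECTOR `y ≥ 0` on cliques with `wt i ≤ ∑_{K ∋ i} y_K`; then `∑_{z ∈ T} w z ≤ ∑_K y_K` for every admissible `7/10`-separated `T`
   (double counting).  A uniform family of valid certificates with `∑ y ≤ Λ` for the priced weight gives `FinPricedLoadCap` (`finPricedLoadCap_of_certs`).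
   CHECKER SKELETON (each a finite check on rational tables once cells are rational boxes in a frame at `(x, q)`): C1 cover · C2 weight majorant
   (univariate/bivariate interval bound of `−V(r) − c·g(r)·a·cos θ`, unimodal pieces) · C3 clique diameter (max squared corner distance `< 49/100`) ·
   C4 dual feasibility (rational linear) · C5 `∑ y ≤ Λ₀` (rational).  C3–C5 are `decide`/`norm_num` rows; C1–C2 are interval lemmas per cell.
§5 THE TWO-PIECE PATH OF ROW 343 in the same format: `FinShellLoad r₁ R E` / `FinShellForce r₁ R F` (isotropic weights `|V|`, `|g|` on the
   shell `r₁ < r ≤ R`, certified by the same `CellCert` with `q := x`: `finShellLoad_of_certs`, `finShellForce_of_certs`), the PROVED splice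
   `farTails_of_shellCerts : FinShellLoad r₁ R E → FinShellForce r₁ R F → FarTails R E' F' → FarTails r₁ (E + E') (F + F')`, and the composed
   reach `contactHotAbove_threeQuarters_of_near_shellCerts`: NEAR finite-range contact law at a branch-and-bound radius `r₁` (tree `FinContactHot`)
   + far LOAD certificate (I-CAP) + far FORCE certificate + integer-shell tails beyond `n` ⟹ HOT, with the budget `β − E − τₙ/6 > −0.711`.

Every `def` below is line vocabulary of the LoopTunnelDial contact dial (crux stmt-AtomisticToContinuum-27294), not a cited fact.  0 sorry.
-/

noncomputable section

namespace Summit.AtomisticToContinuum.Crystallization.Theorems.LoopTunnelDialForcePricing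

open scoped BigOperators Classical InnerProductSpace
open Literature.MathematicalPhysics.StatisticalMechanics
open Literature.MathematicalPhysics.StatisticalMechanics.Yuhjtman2015 (hLJ)
open Summit.AtomisticToContinuum.Crystallization.Theorems.GrainPercolationDialCrossCeiling (E3 ballChunk)
open Summit.AtomisticToContinuum.Crystallization.Theorems.ChargedEnergyGapNegative (eStar)
open Summit.AtomisticToContinuum.Crystallization.Theorems.LoopTunnelDialContactLaw
open Summit.AtomisticToContinuum.Crystallization.Theorems.LoopTunnelDialRangeTails
open Summit.AtomisticToContinuum.Crystallization.Theorems.LoopTunnelDialShellTail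
open Summit.AtomisticToContinuum.Crystallization.Theorems.LoopTunnelDialFinContact
open Summit.AtomisticToContinuum.Crystallization.Theorems.LoopTunnelDialFinPushLoad

variable {N : ℕ}

/-! ### §1 The priced pair weight and the pricing identity (PROVED) -/

/-- **The PRICED PAIR WEIGHT** `pricedTerm c x q z = V(|x − z|) + c · forceTerm x z (q − x)`: the energy of the pair `{x, z}` plus the price `c`
times the force term of `z` on `x` tested against the partner direction `q − x` (`= c·g(r)·⟪z − x, q − x⟫/r`, `g = r⁻¹³ − r⁻⁷`). [line vocabulary · LoopTunnelDial contact dial · crux stmt-AtomisticToContinuum-27294 · definition, not a cited fact] -/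
def pricedTerm (c : ℝ) (x q z : E3) : ℝ := lennardJones (dist x z) + c * forceTerm x z (q - x)

/-- At price `0` the priced weight is the bare pair energy. -/
theorem pricedTerm_zero (x q z : E3) : pricedTerm 0 x q z = lennardJones (dist x z) := by
  unfold pricedTerm; ring

/-- The partner's own force term against its own direction: `forceTerm x q (q − x) = a⁻¹² − a⁻⁶`, `a = |x − q| ≠ 0`. -/
theorem forceTerm_partner {x q : E3} (hxq : x ≠ q) :
    forceTerm x q (q - x) = (dist x q)⁻¹ ^ 12 - (dist x q)⁻¹ ^ 6 := by
  have ha : dist x q ≠ 0 := dist_ne_zero.2 hxq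
  have hinner : ⟪x - q, q - x⟫_ℝ = -(dist x q ^ 2) := by
    rw [show q - x = -(x - q) by abel, inner_neg_right, real_inner_self_eq_norm_sq, dist_eq_norm]
  unfold forceTerm
  rw [hinner]
  field_simp

/-- **THE PRICING IDENTITY (exact, every price).**  At a force-balanced particle `p` with a partner `q ≠ p`:
`𝓔ᵖ = V(a) + c·(a⁻¹² − a⁻⁶) + ∑_{m ≠ p,q} pricedTerm c (y p) (y q) (y m)`, `a = r_{pq}`. [folklore: Lagrange multiplier on the first variation] -/
theorem siteEnergy_eq_priced {y : Fin N → E3} (hy : Function.Injective y) {p q : Fin N} (hpq : p ≠ q) (hF : ForceBalancedAt y p) (c : ℝ) :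
    siteEnergy lennardJones y p =
      lennardJones (dist (y p) (y q)) + c * ((dist (y p) (y q))⁻¹ ^ 12 - (dist (y p) (y q))⁻¹ ^ 6) +
        ∑ m ∈ (Finset.univ.erase p).erase q, pricedTerm c (y p) (y q) (y m) := by
  have hq : q ∈ Finset.univ.erase p := Finset.mem_erase.2 ⟨hpq.symm, Finset.mem_univ _⟩
  have hxq : y p ≠ y q := fun h => hpq (hy h)
  have hE : siteEnergy lennardJones y p =
      lennardJones (dist (y p) (y q)) + ∑ m ∈ (Finset.univ.erase p).erase q, lennardJones (dist (y p) (y m)) := by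
    unfold siteEnergy
    rw [← Finset.add_sum_erase _ _ hq]
  have h0 := (forceBalancedAt_iff y p).1 hF (y q - y p)
  rw [← Finset.add_sum_erase _ _ hq, forceTerm_partner hxq] at h0
  have hsplit : ∑ m ∈ (Finset.univ.erase p).erase q, pricedTerm c (y p) (y q) (y m) =
      ∑ m ∈ (Finset.univ.erase p).erase q, lennardJones (dist (y p) (y m)) +
        c * ∑ m ∈ (Finset.univ.erase p).erase q, forceTerm (y p) (y m) (y q - y p) := by
    unfold pricedTerm
    rw [Finset.sum_add_distrib, Finset.mul_sum]
  have hc : c * ∑ m ∈ (Finset.univ.erase p).erase q, forceTerm (y p) (y m) (y q - y p) =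
      -(c * ((dist (y p) (y q))⁻¹ ^ 12 - (dist (y p) (y q))⁻¹ ^ 6)) := by
    have : ∑ m ∈ (Finset.univ.erase p).erase q, forceTerm (y p) (y m) (y q - y p) =
        -((dist (y p) (y q))⁻¹ ^ 12 - (dist (y p) (y q))⁻¹ ^ 6) := by linarith
    rw [this]; ring
  rw [hE, hsplit, hc]; ring

/-! ### §2 The balance-free priced load capacity and the contact law (PROVED) -/

/-- **`PricedLoadCap ρ c Λ` — THE PRICED ONE-CENTRE CAPACITY (balance-free).**  In every injective `7/10`-separated finite configuration of `ℝ³`,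
at every pair `p ≠ q` closer than `ρ`, the PRICED LOAD is at most `Λ`: `−Λ ≤ ∑_{m ≠ p,q} [V(r_{pm}) + c·forceTerm (y p) (y m) (y q − y p)]`.
No force balance, no ground state: a weighted hard-core packing functional with a dipole weight about the axis `p → q`.  Putative numbers at
`ρ = 3/4` (census CAP5/FIN5, j333138–j333620): `c = 0` ⇒ `Λ ≈ Λ_NP/12 ≈ 3.1` (too weak: needs `< 2.41`); at the break-even price `c ≈ 0.064` the
requirement is `Λ < 4.07` against a rough planner estimate `≈ 3.4–3.7` (census price scan ordered, TAG 129′).  [UNDECIDED (stated test: price scan of the annealed sup) · INSTRUMENTABLE · certifiable by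
`CellCert` (§4)] [line vocabulary · LoopTunnelDial contact dial · crux stmt-AtomisticToContinuum-27294 · definition, not a cited fact] -/
def PricedLoadCap (ρ c Λ : ℝ) : Prop :=
  ∀ (N : ℕ) (y : Fin N → E3), Function.Injective y → (∀ i j : Fin N, i ≠ j → (7 : ℝ) / 10 ≤ dist (y i) (y j)) →
    ∀ p q : Fin N, p ≠ q → dist (y p) (y q) < ρ →
      -Λ ≤ ∑ m ∈ (Finset.univ.erase p).erase q, pricedTerm c (y p) (y q) (y m)

/-- The priced capacity is monotone: a smaller radius and a larger cap are weaker. -/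
theorem pricedLoadCap_mono {ρ ρ' c Λ Λ' : ℝ} (hρ : ρ' ≤ ρ) (hΛ : Λ ≤ Λ') (h : PricedLoadCap ρ c Λ) : PricedLoadCap ρ' c Λ' :=
  fun N y hy hsep p q hpq hlt => by have := h N y hy hsep p q hpq (lt_of_lt_of_le hlt hρ); linarith

/-- Up to the separation constant the priced capacity is vacuous. -/
theorem pricedLoadCap_of_le_seven_tenths {ρ : ℝ} (hρ : ρ ≤ 7 / 10) (c Λ : ℝ) : PricedLoadCap ρ c Λ :=
  fun _ _ _ hsep p q hpq hlt => absurd (lt_of_lt_of_le hlt hρ) (not_lt.2 (hsep p q hpq))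

/-- **THE CONTACT LAW FROM THE PRICED CAPACITY (PROVED).**  `PricedLoadCap ρ c Λ` and a partner floor `m ≤ V(a) + c·(a⁻¹² − a⁻⁶)` for all
`a ∈ [7/10, ρ)` give `ContactHot ρ (m − Λ)` — by the pricing identity, for EVERY price `c`. -/
theorem contactHot_of_pricedLoadCap {ρ c Λ m : ℝ} (hP : PricedLoadCap ρ c Λ)
    (hm : ∀ a : ℝ, 7 / 10 ≤ a → a < ρ → m ≤ lennardJones a + c * (a⁻¹ ^ 12 - a⁻¹ ^ 6)) : ContactHot ρ (m - Λ) := by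
  intro N y hy hsep k l hkl hlt hF
  rw [siteEnergy_eq_priced hy hkl hF c]
  have h1 := hP N y hy hsep k l hkl hlt
  have h2 := hm (dist (y k) (y l)) (hsep k l hkl) hlt
  linarith

/-- **The partner floor at `ρ = 3/4`:** `m(c) = (4/3)¹²·(1/12 + c) − (4/3)⁶·(1/6 + c)`. [line vocabulary · LoopTunnelDial contact dial · crux stmt-AtomisticToContinuum-27294 · definition, not a cited fact] -/
def mThreeQuarters (c : ℝ) : ℝ := (4 / 3 : ℝ) ^ 12 * (1 / 12 + c) - (4 / 3 : ℝ) ^ 6 * (1 / 6 + c)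

/-- `m(c) = 2701312/1594323 + (13791232/531441)·c` (`≈ 1.69433 + 25.9507·c`). -/
theorem mThreeQuarters_eq (c : ℝ) : mThreeQuarters c = 2701312 / 1594323 + 13791232 / 531441 * c := by
  unfold mThreeQuarters; norm_num; ring

/-- `m(0) > 1.694` and the slope exceeds `25.95`: `1.694 + 25.95·c ≤ m(c)` for `c ≥ 0`. -/
theorem mThreeQuarters_ge {c : ℝ} (hc : 0 ≤ c) : 1694 / 1000 + 2595 / 100 * c ≤ mThreeQuarters c := by
  rw [mThreeQuarters_eq]; nlinarith

/-- **PARTNER FLOOR (PROVED):** for `c ≥ 0` and `0 < a ≤ 3/4`, `m(c) ≤ V(a) + c·(a⁻¹² − a⁻⁶)` (`t ↦ (1/12 + c)t² − (1/6 + c)t` increases on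
`t = a⁻⁶ ≥ (4/3)⁶`). -/
theorem partnerFloor_threeQuarters {c a : ℝ} (hc : 0 ≤ c) (ha0 : 0 < a) (ha : a ≤ 3 / 4) :
    mThreeQuarters c ≤ lennardJones a + c * (a⁻¹ ^ 12 - a⁻¹ ^ 6) := by
  have hu : 4 / 3 ≤ a⁻¹ := by
    have h := inv_anti₀ ha0 ha
    norm_num at h ⊢
    exact h
  have hu0 : 0 ≤ a⁻¹ := by positivity
  have ht : (4 / 3 : ℝ) ^ 6 ≤ a⁻¹ ^ 6 := pow_le_pow_left₀ (by norm_num) hu 6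
  have hV : lennardJones a = 1 / 12 * (a⁻¹ ^ 6) ^ 2 - 1 / 6 * a⁻¹ ^ 6 := by unfold lennardJones; ring
  have h12 : a⁻¹ ^ 12 = (a⁻¹ ^ 6) ^ 2 := by ring
  unfold mThreeQuarters
  rw [hV, h12]
  generalize a⁻¹ ^ 6 = t at ht ⊢
  have ht0 : (4 / 3 : ℝ) ^ 12 = ((4 / 3 : ℝ) ^ 6) ^ 2 := by norm_num
  rw [ht0]
  generalize hT : (4 / 3 : ℝ) ^ 6 = t0 at ht ⊢
  have ht05 : 5 ≤ t0 := by rw [← hT]; norm_num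
  -- difference = (t − t0)·((1/12 + c)(t + t0) − (1/6 + c)) ≥ 0
  have h1 : 0 ≤ (t - t0) * (t + t0 - 10) := mul_nonneg (sub_nonneg.2 ht) (by linarith)
  have h2 : 0 ≤ (t - t0) * c := mul_nonneg (sub_nonneg.2 ht) hc
  have h3 : 0 ≤ c * ((t - t0) * (t + t0 - 10)) := mul_nonneg hc h1
  nlinarith [h1, h2, h3]

/-- **HOT ⟸ THE PRICED CAPACITY (PROVED modulo the landed `e⋆ ≤ −0.711`):** for any price `c ≥ 0`,
`PricedLoadCap (3/4) c Λ` with `Λ < m(c) + 0.711` gives `ContactHotAbove (3/4)`. -/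
theorem contactHotAbove_threeQuarters_of_priced {c Λ : ℝ} (he : eStar ≤ -(711 / 1000)) (hc : 0 ≤ c)
    (hP : PricedLoadCap (3 / 4) c Λ) (hΛ : Λ < mThreeQuarters c + 711 / 1000) : ContactHotAbove (3 / 4) :=
  ⟨mThreeQuarters c - Λ, by linarith,
    contactHot_of_pricedLoadCap hP (fun a ha hlt => partnerFloor_threeQuarters hc (by linarith) hlt.le)⟩

/-- **INSTANCE at the break-even price `c = 8/125 = 0.064`:** `m(8/125) > 3.355`, so a priced load `≤ 4` suffices:
`PricedLoadCap (3/4) (8/125) 4 ⟹ ContactHotAbove (3/4)`. -/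
theorem contactHotAbove_threeQuarters_of_priced_064 (he : eStar ≤ -(711 / 1000)) (hP : PricedLoadCap (3 / 4) (8 / 125) 4) :
    ContactHotAbove (3 / 4) :=
  contactHotAbove_threeQuarters_of_priced he (by norm_num) hP (by rw [mThreeQuarters_eq]; norm_num)

/-- The naked (`c = 0`) requirement: `PricedLoadCap (3/4) 0 Λ` with `Λ < 2.405` would suffice — recorded FALSE-IN-EVIDENCE by the census
(non-pusher load `Λ_NP/12 ≥ 3.08`, j333138); the price dial is what makes the capacity route live. -/
theorem contactHotAbove_threeQuarters_of_priced_zero (he : eStar ≤ -(711 / 1000)) {Λ : ℝ} (hP : PricedLoadCap (3 / 4) 0 Λ)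
    (hΛ : Λ < 2405 / 1000) : ContactHotAbove (3 / 4) :=
  contactHotAbove_threeQuarters_of_priced he le_rfl hP (by rw [mThreeQuarters_eq]; norm_num; linarith)

/-! ### §3 The range dial on the priced capacity (PROVED) -/

/-- **`FinPricedLoadCap ρ c Λ R` — FINITE-RANGE PRICED CAPACITY:** in a `7/10`-separated point set inside one closed `R`-ball about `x`, with a
partner `q ≠ x` closer than `ρ`, the priced load of the other points is at most `Λ`.  No balance hypothesis: a pure weighted packing bound, the
object a `CellCert` (§4) certifies. [TRANSFER · DECIDABLE · INSTRUMENTABLE] [line vocabulary · LoopTunnelDial contact dial · crux stmt-AtomisticToContinuum-27294 · definition, not a cited fact] -/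
def FinPricedLoadCap (ρ c Λ R : ℝ) : Prop :=
  ∀ (s : Finset E3) (x q : E3), x ∈ s → q ∈ s → q ≠ x → (∀ z ∈ s, dist x z ≤ R) →
    (∀ z ∈ s, ∀ w ∈ s, z ≠ w → (7 : ℝ) / 10 ≤ dist z w) → dist x q < ρ →
    -Λ ≤ ∑ z ∈ (s.erase x).erase q, pricedTerm c x q z

/-- The finite priced capacity is monotone in `ρ` and `Λ`. -/
theorem finPricedLoadCap_mono {ρ ρ' c Λ Λ' R : ℝ} (hρ : ρ' ≤ ρ) (hΛ : Λ ≤ Λ') (h : FinPricedLoadCap ρ c Λ R) :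
    FinPricedLoadCap ρ' c Λ' R :=
  fun s x q hx hq hqx hR hsep hlt => by have := h s x q hx hq hqx hR hsep (lt_of_lt_of_le hlt hρ); linarith

/-- **PRICED CAPACITY ⟸ its finite-range form + ANY certified tails (PROVED):** for `0 ≤ R`, `ρ ≤ R`, `0 ≤ c`, `0 ≤ F`,
`FarTails R E F ∧ FinPricedLoadCap ρ c Λ R ⟹ PricedLoadCap ρ c (Λ + E + c·ρ·F)` (far energy `≥ −E`; far force against `y q − y p`, a vector of
norm `< ρ`, at least `−F·ρ`). -/
theorem pricedLoadCap_of_fin_of_farTails {ρ c Λ R E F : ℝ} (hR0 : 0 ≤ R) (hρR : ρ ≤ R) (hc : 0 ≤ c) (hF0 : 0 ≤ F)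
    (hT : FarTails R E F) (h : FinPricedLoadCap ρ c Λ R) : PricedLoadCap ρ c (Λ + E + c * ρ * F) := by
  intro N y hy hsep p q hpq hlt
  obtain ⟨hx, hserase, hwithin, hssep, -⟩ := truncation_facts hy hsep p hR0
  set s : Finset E3 := insert (y p) ((nearIdx R y p).image y) with hs
  have hsum_image : ∀ (t : Finset (Fin N)) (g : E3 → ℝ), ∑ z ∈ t.image y, g z = ∑ m ∈ t, g (y m) :=
    fun t g => Finset.sum_image (fun a _ b _ hab => hy hab)
  have hqR : dist (y p) (y q) ≤ R := hlt.le.trans hρR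
  have hl : q ∈ nearIdx R y p := Finset.mem_filter.2 ⟨Finset.mem_erase.2 ⟨hpq.symm, Finset.mem_univ _⟩, hqR⟩
  have hq : y q ∈ s := Finset.mem_insert_of_mem (Finset.mem_image_of_mem y hl)
  have hqx : y q ≠ y p := fun hh => hpq (hy hh).symm
  have hq' : q ∈ Finset.univ.erase p := Finset.mem_erase.2 ⟨hpq.symm, Finset.mem_univ _⟩
  -- the finite statement on the truncation
  have hfin := h s (y p) (y q) hx hq hqx hwithin hssep hlt
  rw [hserase, ← Finset.image_erase hy, hsum_image _ (fun z => pricedTerm c (y p) (y q) z)] at hfin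
  -- split the full priced sum into near (minus q) and far parts
  have hsplit : ∑ m ∈ (Finset.univ.erase p).erase q, pricedTerm c (y p) (y q) (y m) =
      ∑ m ∈ (nearIdx R y p).erase q, pricedTerm c (y p) (y q) (y m) + ∑ m ∈ farIdx R y p, pricedTerm c (y p) (y q) (y m) := by
    have h1 := Finset.add_sum_erase (Finset.univ.erase p) (fun m => pricedTerm c (y p) (y q) (y m)) hq'
    have h2 := Finset.add_sum_erase (nearIdx R y p) (fun m => pricedTerm c (y p) (y q) (y m)) hl
    have h3 := sum_erase_eq_near_add_far R y p (fun m => pricedTerm c (y p) (y q) (y m))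
    linarith
  -- far part: energy ≥ −E, priced force ≥ −c·ρ·F
  have hTk := hT N y hy hsep p
  have hfarV : -E ≤ ∑ m ∈ farIdx R y p, lennardJones (dist (y p) (y m)) := by
    have h1 := Finset.abs_sum_le_sum_abs (fun m => lennardJones (dist (y p) (y m))) (farIdx R y p)
    have h2 := neg_abs_le (∑ m ∈ farIdx R y p, lennardJones (dist (y p) (y m)))
    linarith [hTk.1]
  have hnorm : ‖y q - y p‖ < ρ := by rw [← dist_eq_norm, dist_comm]; exact hlt
  have hfarF : -(ρ * F) ≤ ∑ m ∈ farIdx R y p, forceTerm (y p) (y m) (y q - y p) := by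
    have h1 := hTk.2 (y q - y p)
    have h2 := neg_abs_le (∑ m ∈ farIdx R y p, forceTerm (y p) (y m) (y q - y p))
    have h3 : F * ‖y q - y p‖ ≤ F * ρ := mul_le_mul_of_nonneg_left hnorm.le hF0
    linarith
  have hfar : -(E + c * ρ * F) ≤ ∑ m ∈ farIdx R y p, pricedTerm c (y p) (y q) (y m) := by
    have hsum : ∑ m ∈ farIdx R y p, pricedTerm c (y p) (y q) (y m) =
        ∑ m ∈ farIdx R y p, lennardJones (dist (y p) (y m)) + c * ∑ m ∈ farIdx R y p, forceTerm (y p) (y m) (y q - y p) := by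
      unfold pricedTerm; rw [Finset.sum_add_distrib, Finset.mul_sum]
    rw [hsum]
    have h4 : c * (-(ρ * F)) ≤ c * ∑ m ∈ farIdx R y p, forceTerm (y p) (y m) (y q - y p) := mul_le_mul_of_nonneg_left hfarF hc
    linarith
  rw [hsplit]
  linarith

/-- **The range dial with the integer-shell tail (PROVED):** for `2 ≤ n`, `ρ ≤ n`, `0 ≤ c`,
`FinPricedLoadCap ρ c Λ n ⟹ PricedLoadCap ρ c (Λ + τₙ/6 + c·ρ·(n⁻¹ + n⁻⁷)·τₙ)`. -/
theorem pricedLoadCap_of_fin_shells {ρ c Λ : ℝ} {n : ℕ} (hn : 2 ≤ n) (hρn : ρ ≤ n) (hc : 0 ≤ c) (h : FinPricedLoadCap ρ c Λ n) :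
    PricedLoadCap ρ c (Λ + 1 / 6 * tauShell n + c * ρ * ((((n : ℝ))⁻¹ + ((n : ℝ))⁻¹ ^ 7) * tauShell n)) := by
  have hn0 : (0 : ℝ) ≤ n := by positivity
  have hF0 : 0 ≤ (((n : ℝ))⁻¹ + ((n : ℝ))⁻¹ ^ 7) * tauShell n := mul_nonneg (by positivity) (tauShell_nonneg hn)
  exact pricedLoadCap_of_fin_of_farTails hn0 hρn hc hF0 (farTails_shells hn) h

/-- **STUB 3 ⟸ the finite priced capacity at range `5`, price `8/125`, cap `77/20 = 3.85` (PROVED modulo `e⋆ ≤ −0.711`):** every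
`7/10`-separated point set in one closed `5`-ball about `x` with a partner `q` closer than `3/4` has priced load `≤ 3.85` ⟹ `ContactHotAbove (3/4)`
(tails: `τ₅/6 < 0.2`, `c·ρ·(5⁻¹ + 5⁻⁷)·τ₅ < 0.012`; `3.85 + 0.212 < m(8/125) + 0.711 = 4.066`). -/
theorem contactHotAbove_threeQuarters_of_finPriced5 (he : eStar ≤ -(711 / 1000)) (h : FinPricedLoadCap (3 / 4) (8 / 125) (77 / 20) 5) :
    ContactHotAbove (3 / 4) := by
  have h5 : (2 : ℕ) ≤ 5 := by norm_num
  have hP := pricedLoadCap_of_fin_shells h5 (by norm_num) (by norm_num) h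
  refine contactHotAbove_threeQuarters_of_priced he (by norm_num) hP ?_
  have hτ := tauShell_five_lt
  have hτ0 := tauShell_nonneg h5
  rw [mThreeQuarters_eq]
  push_cast at hP ⊢
  nlinarith

end Summit.AtomisticToContinuum.Crystallization.Theorems.LoopTunnelDialForcePricing
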